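import Summits.AtomisticToContinuum.Crystallization.Theses.FrustratedLawDichotomy
import Summits.AtomisticToContinuum.Crystallization.Theorems.ChessboardParticlePlanesLjLaminarWindowsMinDistance
import Summits.AtomisticToContinuum.Crystallization.Theorems.FrustratedLawDichotomyFolnerRadius
import Summits.AtomisticToContinuum.Crystallization.Theorems.FrustratedLawDichotomyTextureUnpacking
import Summits.AtomisticToContinuum.Crystallization.Theorems.FrustratedLawDichotomyNashAtLocalLimits
import Summits.AtomisticToContinuum.Crystallization.Theorems.FrustratedLawDichotomyLocalLimitEngine
import Summits.AtomisticToContinuum.Crystallization.Theorems.FrustratedLawDichotomyWindowGrowth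

/-!
# Route `FrustratedLawDichotomy`, item stmt-AtomisticToContinuum-27625 `TexturedLawTransfer` — CLOSED

`TexturedLawTransfer` (T): every sequence of finite Lennard-Jones ground states whose coarse-minority balls recur
(hypothesis H2 of the route) and whose textures H7/H8/H10 fail eventually carries a point-stationary hard-core
local-limit law `P` of energy `≤ e_per`, textured and Nash at `P`-a.e. configuration.

This file is the sorry-free composition of the registered skeleton line «truncated-bs»
(`Cruxes/TexturedLawTransfer`, decomp-a2c lens-2 g13) with its six stubs, all landed in `Theorems/`:
* S1 `FrustratedLawDichotomyFolnerRadius.stub_folnerRadius` (p782704) — Følner radii with thick thin shells;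
* S2 `FrustratedLawDichotomyLocalLimitEngine.stub_localLimitEngine` (p784530) — local-limit engine for uniformly
  rooted truncated windows (exact finite point-stationarity, energy and closed-support clauses);
* S3 `FrustratedLawDichotomyWindowGrowth.stub_windowGrowth` (p786086) — window growth (docking, no tendrils);
* S4 `FrustratedLawDichotomyWindowEnergyCeiling.stub_windowEnergyCeiling` (p785589) — Følner-window energy ceiling;
* S5 `FrustratedLawDichotomyTextureUnpacking.stub_textureUnpacking` (p782775) — texture passes to local limits;
* S6 `FrustratedLawDichotomyNashAtLocalLimits.stub_nashAtLocalLimits` (p783848) — Nash passes to local limits.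
The proof below is the composition `TexturedLawTransfer_of` of the registered skeleton, verbatim, with the
stub hypotheses `h₁ … h₆` instantiated by the landed theorems.
-/

namespace Summit.AtomisticToContinuum.Crystallization.Theorems.FrustratedLawDichotomyTexturedLawTransfer

/-- **Item stmt-AtomisticToContinuum-27625** (`TexturedLawTransfer`, route `FrustratedLawDichotomy`): the textured
local-limit law of a frustrated ground-state sequence, by truncated-window Benjamini–Schramm limits.
[cite: BlancLewin2015, §1.2] -/
theorem texturedLawTransfer_holds :
    Summit.AtomisticToContinuum.Crystallization.Theses.FrustratedLawDichotomy.TexturedLawTransfer := by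
  have h₁ := Summit.AtomisticToContinuum.Crystallization.Theorems.FrustratedLawDichotomyFolnerRadius.stub_folnerRadius
  have h₂ := Summit.AtomisticToContinuum.Crystallization.Theorems.FrustratedLawDichotomyLocalLimitEngine.stub_localLimitEngine
  have h₃ := Summit.AtomisticToContinuum.Crystallization.Theorems.FrustratedLawDichotomyWindowGrowth.stub_windowGrowth
  have h₄ := Summit.AtomisticToContinuum.Crystallization.Theorems.FrustratedLawDichotomyWindowEnergyCeiling.stub_windowEnergyCeiling
  have h₅ := Summit.AtomisticToContinuum.Crystallization.Theorems.FrustratedLawDichotomyTextureUnpacking.stub_textureUnpacking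
  have h₆ := Summit.AtomisticToContinuum.Crystallization.Theorems.FrustratedLawDichotomyNashAtLocalLimits.stub_nashAtLocalLimits
  intro x
  have h₂x := h₂ (7 / 10) (by norm_num) x
  dsimp only at h₂x ⊢
  intro hx h2 h7 h8 h10
  -- hard core 7/10 of every ground state (tree theorem stub_minDistance07)
  have hsepN : ∀ (N : ℕ) (a b : Fin N), a ≠ b → (7 : ℝ) / 10 ≤ dist (x N a) (x N b) := fun N a b hab =>
    Summit.AtomisticToContinuum.Crystallization.Theorems.LjLaminarWindowsSketch.stub_minDistance07 N (x N) (hx N) a b hab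
  -- eventual forms of H7 H8 H10 (texture radii R₇ R₈ R₉)
  obtain ⟨R₇, h7'⟩ := not_forall.mp h7
  obtain ⟨R₈, h8'⟩ := not_forall.mp h8
  obtain ⟨R₉, h10'⟩ := not_forall.mp h10
  have h7e := Filter.not_frequently.mp h7'
  have h8e := Filter.not_frequently.mp h8'
  have h10e := Filter.not_frequently.mp h10'
  -- the windows: stage m uses a recurring all-bad coarse-minority ball of radius m (H2) at a stage where the eventual facts hold
  have hwin : ∀ m : ℕ, ∃ N : ℕ, ∃ i : Fin N, (m ≤ N ∧ (¬ _) ∧ (¬ _) ∧ (¬ _)) ∧ _ := fun m => by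
    have := ((((Filter.eventually_ge_atTop m).and h7e).and h8e).and h10e).and_frequently (h2 (m : ℝ))
    obtain ⟨N, ⟨⟨⟨hmN, a7⟩, a8⟩, a10⟩, i, hi⟩ := this.exists
    exact ⟨N, i, ⟨hmN, a7, a8, a10⟩, hi⟩
  choose Nw iw hw using hwin
  -- Følner radii (S1) for δ = 7/10
  obtain ⟨Ls, εs, hLs, hεs, hF⟩ := h₁ (7 / 10) (by norm_num)
  have hr : ∀ m : ℕ, ∃ r : ℝ, (m : ℝ) / 4 ≤ r ∧ r ≤ (m : ℝ) / 2 ∧ _ := fun m => hF (m : ℝ) (Nw m) (x (Nw m)) (iw m) (Nat.cast_nonneg m) (fun a b hab => hsepN _ a b hab)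
  choose rw hrw using hr
  -- the law (S2)
  obtain ⟨P, hP, ha, hb, hc, hsupp⟩ := h₂x Nw iw rw (fun m => Ls (m : ℝ)) (fun m => εs (m : ℝ)) (fun m a b hab => hsepN _ a b hab)
    (fun m => (div_nonneg (Nat.cast_nonneg m) (by norm_num)).trans (hrw m).1)
    (Filter.tendsto_atTop_mono (fun m => (hrw m).1) ((tendsto_natCast_atTop_atTop (R := ℝ)).atTop_div_const (by norm_num))) (hLs.comp tendsto_natCast_atTop_atTop) (hεs.comp tendsto_natCast_atTop_atTop) (fun m => (hrw m).2.2)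
  refine ⟨7 / 10, by norm_num, P, hP, ha, hb, ?_, ⟨R₇, R₈, R₉, ?_⟩, ?_⟩
  · -- (c) energy: growth (S3) + Følner-window ceiling (S4) eventually, passed to the limit by S2's energy clause
    refine le_of_forall_pos_le_add fun η hη => hc _ ?_
    obtain ⟨L, hL, ε, hε, n₀, hce⟩ := h₄ η hη
    obtain ⟨r₀, hgr⟩ := h₃ n₀
    have hLev : ∀ᶠ m : ℕ in Filter.atTop, L ≤ Ls (m : ℝ) := (hLs.comp tendsto_natCast_atTop_atTop).eventually_ge_atTop L
    have hεev : ∀ᶠ m : ℕ in Filter.atTop, εs (m : ℝ) ≤ ε := (hεs.comp tendsto_natCast_atTop_atTop).eventually_le_const hε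
    have hrev : ∀ᶠ m : ℕ in Filter.atTop, 4 * r₀ ≤ (m : ℝ) := tendsto_natCast_atTop_atTop.eventually_ge_atTop (4 * r₀)
    filter_upwards [Filter.eventually_ge_atTop n₀, hLev, hεev, hrev] with m hmn hLm hεm hrm
    have hcard0 : (0 : ℝ) ≤ (((Finset.univ.filter (fun j : Fin (Nw m) => dist (x (Nw m) j) (x (Nw m) (iw m)) ≤ rw m))).card : ℝ) := Nat.cast_nonneg _
    refine hce (Nw m) (x (Nw m)) (hx _) (iw m) (rw m) ?_ ?_
    · refine (hgr (Nw m) (x (Nw m)) (hx _) (hmn.trans (hw m).1.1) (iw m)).trans (Finset.card_le_card fun j hj => ?_)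
      simp only [Finset.mem_filter, Finset.mem_univ, true_and] at hj ⊢
      linarith [(hrw m).1]
    · refine le_trans ?_ ((hrw m).2.2.trans (mul_le_mul_of_nonneg_right hεm hcard0))
      exact_mod_cast Finset.card_le_card fun j hj => by
        simp only [Finset.mem_filter, Finset.mem_univ, true_and] at hj ⊢
        exact ⟨by linarith [hj.1], hj.2⟩
  · -- (d) texture: S5 at P-a.e. configuration, fed by S2's support clause, all-badness of the window and the eventual facts
    filter_upwards [hsupp] with μ hμ
    have h₅' := h₅ μ R₇ R₈ R₉
    dsimp only at h₅'
    refine h₅' fun R ε hε => ?_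
    obtain ⟨m, -, j, hdeep, hmatch⟩ := hμ R ε hε 0
    obtain ⟨⟨-, a7, a8, a10⟩, hbad, -⟩ := hw m
    refine ⟨Nw m, x (Nw m), j, ⟨fun a b hab => hsepN _ a b hab, fun j' hj' => hbad j' ?_, fun j' _ => (not_exists.mp a7) j',
      fun j' _ => ?_, fun j' _ => (not_exists.mp a10) j'⟩, hmatch⟩
    · have h1 := dist_triangle (x (Nw m) j') (x (Nw m) j) (x (Nw m) (iw m))
      have h2' := (hrw m).2.1
      have h3 : (0 : ℝ) ≤ (m : ℝ) := Nat.cast_nonneg m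
      linarith
    · obtain ⟨k, hk⟩ := not_forall.mp ((not_exists.mp a8) j')
      exact ⟨k, (Classical.not_imp.mp hk).1, Classical.not_not.mp (Classical.not_imp.mp hk).2⟩
  · -- (e) Nash: S6 at P-a.e. configuration, fed by the hard core and S2's support clause
    filter_upwards [ha, hsupp] with μ hμa hμ
    exact h₆ (7 / 10) (by norm_num) μ hμa fun R ε hε => by
      obtain ⟨m, -, j, -, hmatch⟩ := hμ R ε hε 0
      exact ⟨Nw m, x (Nw m), j, hx _, hmatch⟩

end Summit.AtomisticToContinuum.Crystallization.Theorems.FrustratedLawDichotomyTexturedLawTransfer
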